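import Summits.Ventures.HSemireg.Pad4TowerSeedB1

/-!
# Venture HSemireg — PAD-4 on 𝔅(μ₄): LINE 5 SEED (B1-odd) at ◇₈, `G₁ = ⟨Δ⟩ × S₄`, `H_odd = H₁ = {X+, A2I−}` — «no fully charged class of ODD
# parity weight on a static-clean support» as a TYPED STATEMENT (no proof), and the PROVED corollary with gs-eng-2's Ψ-LINE PROPOSITION:
# on δ-balanced such supports every (A1) multiplicity vector has `μ = 0`

HONEST FRAMING. Lean index of the computation cell `pub-hsemireg` (S4-PUSH, H2 door PAD-4), typed by the Ventures-side typer
`hodge-lit-semireg-typer-2` (g6; line of record stmt-HodgeConjecture-18881 `Cruxes/BlochSeedDiscOne/Lines/birth.lean` 814a6a70c14e831a,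
stub `stub_rung_pad4_seedAt`). Sequel of `Pad4TowerSeedB1` ((B1), H₁). WHAT THIS FILE IS: the statement file of LINE 5 (i) result **r2** (bc5-plan
g7, cell INBOX l.32589; kit j305149 `W-CORE-FAM-D8-G1-v19`, variant `odd_fc` = STATIC + «some FC orbit of ODD parity weight present» — xres2s
v19-famcore DIFF 337832a52d616661: `ODDFC = [i : isFC ∧ Σρ odd]` added as ONE presence clause; no FC-CORE, no Ψ): control `all` (12 532 284 ∕
60 509 540, = expected header) kissat UNSAT 1 195 s; greedy deletion FC1 NOT needed (UNSAT 787 s), X− NOT (527 s), **X+ NEEDED** (SAT 45 s: the full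
support), **A2I− NEEDED** (SAT 62 s: a 26-orbit ∕ 976-class floor-hung support whose FC cells are floor cells with ODD patterns, e.g.
`N[ℓ₋₁|ℓ₋₁|ℓ₋₁|ℓ₋ᵢ]`; witness `witness-famcore-odd_fc-minus-A2Im-kissat.json`), A2I+ NOT (1 021 s); **`H_odd = RULE-D + {X+, A2I−} = H₁`; cadical UNSAT
1 221 s on the minimal CNF (12 276 316 ∕ 50 851 365) ⇒ ×2.** bc5-plan's typed shape (l.32589, verbatim): «`SeedB1OddDiamond8G1H1 := ∀ C,
C.InDiamond 8 → C.G1Closed → C.StaticH1 → ¬ C.HasOddFC` with `HasOddFC` := some present FC cell of parity weight 1 or 3 — the encoder's one clause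
over the 30 800 odd orbit literals». STATUS WORDS: `SeedB1OddDiamond8G1H1` is a TYPED STATEMENT in HYPOTHESIS FORM — machine ×2 at INSTANCE
level, NO proof (the static lemma «RULE-D ∧ X⁺-closed ∧ A2I⁻-closed ∧ G₁-closed ∧ ◇₈ ⇒ no odd-weight FC orbit» is LINE 5 (iii)'s ONE pencil target,
bc5-plan l.32589); NOT asserted, no `axiom`, no `sorry`; not a Literature fact; nothing here is an object or a census row.

WHY IT MATTERS (the factorisation of the FC-CORE kill, r2 READING): by gs-eng-2 g52's PROPOSITION ((P) `Pad4TowerPsiLine.odd_core_of_psiDefect_balance`,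
PROVED): on a support whose signed Ψ-defect `δ = Ψ − [FC]·C±` is level-balanced under the multiplicities (e.g. `δ ≡ 0`: every present cell a LINE
cell), (A1) forces `Re μ = 0`, so `μ ≠ 0` needs the ODD core — present FC classes of parity weights 1 and 3. The seed says the static game leaves
none. Hence the PROVED COROLLARY `wch_eWord_eq_zero_of_seedB1Odd`: GRANTED THE SEED, every INTEGER multiplicity vector (positivity not needed) on a
`G₁`-closed `H₁`-static two-level support in ◇₈ that passes (A1) with balanced δ has `μ = 0`. ((B1) of `Pad4TowerSeedB1` covers all supports with
positive multiplicities; (B1-odd) + δ-balance is the SHORTER ROAD of bc5-plan's reading key §2 ∕ g52's LEMMA Ψ-LINE §2.)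

THE TWO SIDES, LITERALLY. HYPOTHESIS `StaticH1` (= r2's `H_odd`; `Pad4TowerSeedB1`), support `InDiamond 8` with `G1Closed` levels (as in (B1)).
CONCLUSION `¬ HasOddFC C`: **`MConfig.HasOddFC`** := a present fully charged class, at either level, of one of the eight ODD-weight parity patterns
(`OddPat κ`: `0001, 0010, 0100, 1000` = `1, 2, 4, 8`; `0111, 1011, 1101, 1110` = `7, 11, 13, 14`; `oddPat_iff_pwt`: ⟺ `pwt κ` odd), bounded
over the two levels (decidable; (J)'s unbounded `HasFC κ` feeds it through `hasOddFC_of_hasFC`); the encoder's `parity_info` has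
`ρ_f = phase index mod 2`, which on the axis letters of ◇_h is `kbit` (`Im β ≠ 0`), so «Σρ odd» = «odd parity weight» = these eight patterns.

CONTENT. §1 `OddPat`, `oddPat_iff_pwt`, `MConfig.HasOddFC` (decidable), `hasOddFC_of_hasFC` ∕ `_one` (injections used by the corollary). §2 **`SeedB1OddDiamond8G1H1 : Prop`**
(typed statement) and `SeedB1OddDiamond8G1Static4` (all four families; weaker) + `seedB1OddStatic4_of_H1`. §3 PROVED COROLLARY
**`wch_eWord_eq_zero_of_seedB1Odd`** (seed + δ-balance + (A1) ⇒ `μ = 0`, any integer multiplicities). §3b **`SeedDeltaDiamond8G1H1 : Prop`**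
((B1-δ) «static-clean ⇒ δ ≡ 0 on the support», second hypothesis-form def, bc5-plan l.32404 (A)) and PROVED
**`wch_eWord_eq_zero_of_seedB1Odd_of_seedDelta`**: (B1-odd) ∧ (B1-δ) ⇒ the (B1) KILL (`μ = 0` for every (A1) integer multiplicity vector on such a
support) — director-hodge R13.71 (2); the presence-level «(B1-odd) ∧ (B1-δ) ⇒ (B1)» is NOT claimed.
§4 probes (`decide`): `HasOddFC` holds on the r2 witness shape `N[ℓ₁|ℓ₁|ℓ₁|ℓ_i]` ∪ orbit-mates and fails on `diagFour`.

WHAT IS NOT HERE ∕ NOT IN LEAN. No proof of the seed; no (B2) (r3 `full` pending at typing time — sequel); no `G′ = ⟨Δ²⟩ × S₄` ∕ ◇₁₀ form (LINE 4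
attribution ∕ j308425 pending — sequels «then, not before», l.32589); no FC1 (∉ H₁ ∪ H_odd). NOTHING HERE SAYS THAT HC ∕ HC_CM ∕ HC_AV ∕ W₆ ∕
HC_Kum4Type HOLDS OR FAILS; typed ≠ proved ≠ endorsed. No `instance`, no notation, no Literature fact, 0 `sorry`; axioms standard.

SOURCES (sha16 ∕ bus): bc5-plan g7 r2 l.32589 (numbers, witness name, typed shape), r1 l.32495, template 35a591490aa3302d, reading key
`work/g7/LINE5-FAMCORE-READING-KEY.md` §2–§3, famcore DIFF 337832a52d616661 (`ODDFC`); gs-eng-2 g52 r1∕r2 readings l.32496, LEMMA-PSILINE v1.1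
92f862dc99a9944c; director-hodge g13 R13.43 (2), R13.48, R13.60, R13.64, R13.71 (l.32595: KEY (T) authorised after (S); (B1-δ) clause); xres2s.py v19 c7ee80d7dccc0bfd `parity_info` l.776; `Pad4TowerSeedB1.lean`
1a6ad58bf6c2b9bc (this typer), `Pad4TowerPsiLine.lean` 7b782c3bf0340245 ((P), g52's PROPOSITION typed by g5), `Pad4TowerFCCoreParitySeam.lean` (`HasFC`). -/

namespace Summit.Ventures.HSemireg.Pad4Tower

open Finset

/-! ## §1 The conclusion side: an FC class of odd parity weight is present -/

/-- the eight parity patterns of ODD weight: `0001, 0010, 0100, 1000` (weight 1) and `0111, 1011, 1101, 1110` (weight 3). Decidable. -/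
abbrev OddPat (κ : Fin 16) : Prop := κ = 1 ∨ κ = 2 ∨ κ = 4 ∨ κ = 8 ∨ κ = 7 ∨ κ = 11 ∨ κ = 13 ∨ κ = 14

/-- `OddPat` is «parity weight odd» on all sixteen patterns. [`decide`] -/
theorem oddPat_iff_pwt : ∀ κ : Fin 16, OddPat κ ↔ pwt κ % 2 = 1 := by decide

/-- **an FC class of ODD parity weight is present** (the `odd_fc` presence clause `ODDFC`: `isFC ∧ Σρ odd`): some present fully charged class,
at either level, has an odd-weight pattern. Bounded over the two levels, hence decidable. -/
abbrev MConfig.HasOddFC (C : MConfig) : Prop :=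
  (∃ Z ∈ C.lower, FCc Z ∧ OddPat Z.pat) ∨ (∃ P ∈ C.upper, FCc P ∧ OddPat P.pat)

/-- (J)'s `HasFC κ` at an odd pattern gives `HasOddFC`. -/
theorem MConfig.hasOddFC_of_hasFC {C : MConfig} {κ : Fin 16} (hκ : OddPat κ) (h : C.HasFC κ) : C.HasOddFC := by
  obtain ⟨Z, hZ | hZ, hfc, hp⟩ := h
  · exact Or.inl ⟨Z, hZ, hfc, hp ▸ hκ⟩
  · exact Or.inr ⟨Z, hZ, hfc, hp ▸ hκ⟩

/-- pattern `0001` is odd. -/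
theorem MConfig.hasOddFC_of_hasFC_one {C : MConfig} (h : C.HasFC 1) : C.HasOddFC := MConfig.hasOddFC_of_hasFC (Or.inl rfl) h

/-! ## §2 The seed (B1-odd) — TYPED STATEMENT, machine ×2 at instance level (r2), NO proof -/

/-- **LINE 5 SEED (B1-odd) at ◇₈, `G₁`, `H_odd = H₁`** (bc5-plan's shape, l.32589): for every two-level configuration of 𝔅(μ₄) cells inside ◇₈
whose levels are each `G₁`-closed, RULE-D closure with `X+`- and `A2I−`-closedness excludes every fully charged class of odd parity weight.
EVIDENCE (instance level, not a proof): kit j305149 r2 — `odd_fc all` kissat UNSAT 1 195 s; on RULE-D + {X+, A2I−} (+ FC-mass + ODD-FC presence)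
kissat UNSAT 1 021 s, cadical UNSAT 1 221 s on the same CNF (12 276 316 ∕ 50 851 365). A HYPOTHESIS-FORM DEF: NOT asserted, no `axiom`, no
`sorry`; TYPED STATEMENT ONLY. -/
def SeedB1OddDiamond8G1H1 : Prop :=
  ∀ C : MConfig, C.InDiamond 8 → C.G1Closed → C.StaticH1 → ¬ C.HasOddFC

/-- the same seed under the STRONGER bundle of all four instance families — a WEAKER statement. -/
def SeedB1OddDiamond8G1Static4 : Prop :=
  ∀ C : MConfig, C.InDiamond 8 → C.G1Closed → C.StaticFour → ¬ C.HasOddFC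

/-- the four-family odd seed follows from the `H₁` one. -/
theorem seedB1OddStatic4_of_H1 (h : SeedB1OddDiamond8G1H1) : SeedB1OddDiamond8G1Static4 :=
  fun C hU hG hS => h C hU hG (MConfig.staticH1_of_staticFour hS)

/-! ## §3 The corollary: granted the seed, δ-balanced (A1) multiplicity vectors have `μ = 0` (PROVED modulo the seed) -/

/-- **COROLLARY (the shorter road, GRANTED THE SEED).** If `SeedB1OddDiamond8G1H1` holds, then on every `G₁`-closed `H₁`-static two-level support in
◇₈, every INTEGER multiplicity vector whose weighted class tensor passes the class screen (A1) and whose signed Ψ-defect is level-balanced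
(`Σ_N m_N δ(N) = Σ_P m_P δ(P)`; automatic when every present cell is a line cell, (P) `psiDefect_eq_zero_of_line`) has `μ = wch(eeee) = 0`.
[(P) `odd_core_of_psiDefect_balance`: δ-balance + (A1) + `μ ≠ 0` ⇒ `HasFC 1`; the seed forbids it.] -/
theorem wch_eWord_eq_zero_of_seedB1Odd (hseed : SeedB1OddDiamond8G1H1) (C : MConfig) (hU : C.InDiamond 8) (hG : C.G1Closed)
    (hS : C.StaticH1) (mN mP : MCell → ℤ) (hA : ClassScreen (C.wch mN mP))
    (hδ : ∑ Z ∈ C.lower, (mN Z : ℚ) * Z.psiDefect = ∑ P ∈ C.upper, (mP P : ℚ) * P.psiDefect) : C.wch mN mP eWord = 0 := by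
  by_contra hμ
  obtain ⟨hN, hP⟩ := MConfig.axisCell_of_inDiamond hU
  obtain ⟨-, h1, -⟩ := C.odd_core_of_psiDefect_balance mN mP hN hP hA hδ hμ
  exact hseed C hU hG hS (MConfig.hasOddFC_of_hasFC_one h1)

/-- the same from the four-family seed under the four-family bundle. -/
theorem wch_eWord_eq_zero_of_seedB1OddStatic4 (hseed : SeedB1OddDiamond8G1Static4) (C : MConfig) (hU : C.InDiamond 8)
    (hG : C.G1Closed) (hS : C.StaticFour) (mN mP : MCell → ℤ) (hA : ClassScreen (C.wch mN mP))
    (hδ : ∑ Z ∈ C.lower, (mN Z : ℚ) * Z.psiDefect = ∑ P ∈ C.upper, (mP P : ℚ) * P.psiDefect) : C.wch mN mP eWord = 0 := by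
  by_contra hμ
  obtain ⟨hN, hP⟩ := MConfig.axisCell_of_inDiamond hU
  obtain ⟨-, h1, -⟩ := C.odd_core_of_psiDefect_balance mN mP hN hP hA hδ hμ
  exact hseed C hU hG hS (MConfig.hasOddFC_of_hasFC_one h1)

/-! ## §3b (B1-δ) as a second hypothesis-form def, and «(B1-odd) ∧ (B1-δ) ⇒ the (B1) kill» (director-hodge R13.71 (2)) -/

/-- **(B1-δ) «static-clean ⇒ δ-balanced»** (bc5-plan g7 l.32404 (A), gs-eng-2 g52 LEMMA Ψ-LINE: the Ψ-defect `δ = Ψ − [FC]·C±` vanishes on every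
class of every static-clean `G₁`-closed two-level support in ◇₈ — machine-true on all 1 915 classes of the 14 static-clean ◇₈ survivors
(`psi_line_check.py` 0027d5eb91406a48); NO proof; (CUL-8)-type statement). A HYPOTHESIS-FORM DEF, NOT asserted; TYPED STATEMENT ONLY. -/
def SeedDeltaDiamond8G1H1 : Prop :=
  ∀ C : MConfig, C.InDiamond 8 → C.G1Closed → C.StaticH1 → ∀ Z, (Z ∈ C.lower ∨ Z ∈ C.upper) → Z.psiDefect = 0

/-- **(B1-odd) ∧ (B1-δ) ⇒ THE (B1) KILL, for ALL integer multiplicities** (R13.71 (2), in the form that type-checks: the two hypothesis-form seeds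
give the COROLLARY of (B1) — `μ = 0` for every (A1) multiplicity vector on such a support, here even without positivity —; the presence-level
implication «(B1-odd) ∧ (B1-δ) ⇒ `SeedB1Diamond8G1H1`» is a different statement and is NOT claimed). [δ ≡ 0 makes both δ-sums vanish;
then `wch_eWord_eq_zero_of_seedB1Odd`.] -/
theorem wch_eWord_eq_zero_of_seedB1Odd_of_seedDelta (hodd : SeedB1OddDiamond8G1H1) (hdelta : SeedDeltaDiamond8G1H1) (C : MConfig)
    (hU : C.InDiamond 8) (hG : C.G1Closed) (hS : C.StaticH1) (mN mP : MCell → ℤ) (hA : ClassScreen (C.wch mN mP)) :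
    C.wch mN mP eWord = 0 := by
  have h1 : ∑ Z ∈ C.lower, (mN Z : ℚ) * Z.psiDefect = 0 :=
    Finset.sum_eq_zero fun Z hZ => by rw [hdelta C hU hG hS Z (Or.inl hZ), mul_zero]
  have h2 : ∑ P ∈ C.upper, (mP P : ℚ) * P.psiDefect = 0 :=
    Finset.sum_eq_zero fun P hP => by rw [hdelta C hU hG hS P (Or.inr hP), mul_zero]
  exact wch_eWord_eq_zero_of_seedB1Odd hodd C hU hG hS mN mP hA (by rw [h1, h2])


/-! ## §4 Probes (`decide`) -/

section Probes

/-- the r2 drop-out witness SHAPE (without A2I−): a floor FC cell with an odd pattern, `N[ℓ₁|ℓ₁|ℓ₁|ℓ_i]` (pattern `0001`), alone at level `N`. -/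
def oddFloorCfg : MConfig := ⟨{mcellOf (lpt 1 0) (lpt 1 0) (lpt 1 0) (lpt 1 1)}, ∅⟩

set_option synthInstance.maxSize 8192 in
set_option synthInstance.maxHeartbeats 2000000 in -- large decidable instances, as in the family files
/-- `HasOddFC` computes: it HOLDS on the odd floor cell (pattern `0001 = 1`, in ◇₈) and FAILS on `diagFour = {[ℓ_u]⁴}` (patterns `0000`, `1111` only).
[kernel, `decide`] -/
theorem hasOddFC_probe : oddFloorCfg.InDiamond 8 ∧ oddFloorCfg.HasOddFC ∧ ¬ diagFour.HasOddFC := by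
  refine ⟨?_, ?_, ?_⟩ <;> decide +kernel

end Probes

end Summit.Ventures.HSemireg.Pad4Tower
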